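import Summits.AnomalousDissipation.AnomalousDissipation.Theorems.SolenoidalFractalHomogenisationLagrangianStepSidebandXGen
import Summits.AnomalousDissipation.AnomalousDissipation.Theorems.SolenoidalFractalHomogenisationLagrangianStepTransverseSymbolLipschitz
import Summits.AnomalousDissipation.AnomalousDissipation.Theorems.SolenoidalFractalHomogenisationLagrangianStepCellChainFastEnergy
import HarnessLib

/-!
# K1L_D `LagrangianRenormalisationStepDesign` (stmt-AnomalousDissipation-27980), `stub_D1_V0` (V0 = clause (ii) of
# `WCrossing.D1ExactFamily`), brick T4c-3a: ALGEBRA OF THE DEFECT — class-vs-integer link coefficients, symbol homogeneity, the Leray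
# projection of a nearby wave vector, and the VISCOUS ξ-DEFECT PAIRING BOUND (helper; `--kind proof --supports stmt-AnomalousDissipation-27980 --as helper`)

Summits-side helper file of route `SolenoidalFractalHomogenisation` (prover seat `ad-k1l-cellLawV-w1` g6).  Everything proved; no definitions, no named
facts, no sorry.  The defect of `…SidebandXResidual.hasDerivWithinAt_residual` compares the finite-ξ generator `genX W₁ n ℓ ((1/n²)•𝔸) γ₁ R` (class
frequencies `k_z = ℓ + n·z`) with the reference `gen W₁ 𝔸 γ₁ R` (integer `z`).  This file supplies the exact algebra and the one analytic input:
* `linkCoeff_classFreq_eq_add` — `linkCoeffⱼ(ℓ + n·z) = linkCoeffⱼ¹(z) + linkCoeffⱼ(ℓ)` (`n ≥ 1`; the second term is `ξⱼ·2πi·envⱼ`, `O(|ξ|)`);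
* `classFreq_zero_left`, `symbT_classFreq_zero`, `freqNormSq_classFreq_zero`, `kdot_classFreq_zero`, `transversalProj_classFreq_zero` — at `ℓ = 0`
  the class frequency is `n·z`: `T_𝔸(n·z) = n²·T_𝔸(z)`, `|n·z|² = n²|z|²`, `P_{n·z} = P_z`;
* `norm_transversalProj_waveVecC_le` — `‖P_k (waveVecC k₀)‖ ≤ √|k − k₀|²` (the projection kills its own direction; used for the source defect
  `P_{k_{mⱼ}}(1 − P_{mⱼ}) x`), `norm_transversalProj_sub_proj_le` — `‖P_k(v − P_{k₀} v)‖ ≤ (√|k−k₀|²/√|k₀|²)·‖v‖`;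
* **`abs_re_visc_defect_le`** — THE VISCOUS ξ-DEFECT PAIRING: for `z ≠ 0`, `4|ℓ|² ≤ n²|z|²` and ALL `r, y ∈ ℂ³`,
  `|Re⟪P_{k_z} r, T_{((1/n²)•𝔸)}(k_z) P_{k_z} y⟫ − Re⟪P_z r, T_𝔸(z) P_z y⟫| ≤ 534·K₀·√|z|²·(√|ℓ|²/n)·‖y‖‖r‖` with `K₀` any transverse bound of
  `bsymb 𝔸` (`…SymbolLipschitz.abs_re_inner_symbT_proj_sub_le` at `k₀ = n·z`): relative size `|z|·|ξ|` — FINDING F-w1g6-1, to be absorbed by the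
  dissipation weight `|k_z|²` of `…SidebandXResidual.two_inner_genX_add_le`.
NOT a proof of any registered stub, of K1L_D, or of anomalous dissipation; rung F-D1.A0 infrastructure.
-/

set_option linter.dupNamespace false

noncomputable section

namespace Summit.AnomalousDissipation.AnomalousDissipation.Theorems.SolenoidalFractalHomogenisation.LagrangianStep.Sideband

open Set MeasureTheory Complex UnitAddTorus
open scoped InnerProductSpace
open Literature.Analysis Literature.Analysis.FunctionSpaces Literature.Analysis.FunctionSpaces.Torus
open Literature.Analysis.FluidPDE Literature.Analysis.FluidPDE.Torus Literature.Analysis.FluidPDE.LatticeShear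
open Summit.AnomalousDissipation.AnomalousDissipation.Theorems.SolenoidalFractalHomogenisation.LagrangianStep.CellChain (linkCoeff linkCoeff_def)

variable {k₀ : ℕ}

/-! ## §1 Class link coefficient = integer link coefficient + slow link coefficient -/

/-- **`linkCoeffⱼ(ℓ + n·z) = linkCoeffⱼ¹(z) + linkCoeffⱼ(ℓ)`** (`n ≥ 1`): the class link coefficient of the cell problem at cell number `n` differs
from the `n = 1` integer-lattice one (used by `Sideband.gen`) exactly by the slow coefficient `ξⱼ·2πi·envⱼ(t)`. [cite: MeshalkinSinai1961, pp. 1700–1705] -/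
theorem linkCoeff_classFreq_eq_add (W₁ : LatticeWord k₀) {n : ℕ} (hn : n ≠ 0) (ℓ z : Fin 3 → ℤ) (j : Fin k₀) (t : ℝ) :
    linkCoeff W₁ n (classFreq n ℓ z) j t = linkCoeff W₁ 1 z j t + linkCoeff W₁ n ℓ j t := by
  have hn' : (n : ℂ) ≠ 0 := by exact_mod_cast hn
  rw [linkCoeff_def, linkCoeff_def, linkCoeff_def]
  have hs : (∑ a, ((W₁.phase j).e a : ℂ) * ((classFreq n ℓ z a : ℤ) : ℂ))
      = (∑ a, ((W₁.phase j).e a : ℂ) * ((ℓ a : ℤ) : ℂ)) + (n : ℂ) * ∑ a, ((W₁.phase j).e a : ℂ) * ((z a : ℤ) : ℂ) := by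
    rw [Finset.mul_sum, ← Finset.sum_add_distrib]
    refine Finset.sum_congr rfl fun a _ => ?_
    rw [classFreq_apply]; push_cast; ring
  rw [hs]
  push_cast
  field_simp
  ring

/-! ## §2 The class base point `n·z`: homogeneity of the symbol, scale invariance of the projection -/

/-- `classFreq n 0 z = n·z`. [cite: MajdaKramer1999, §2.2.1.3] -/
theorem classFreq_zero_left (n : ℕ) (z : Fin 3 → ℤ) (i : Fin 3) : classFreq n 0 z i = (n : ℤ) * z i := by
  simp [classFreq]

/-- `k_z − n·z = ℓ`. [cite: MajdaKramer1999, §2.2.1.3] -/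
theorem classFreq_sub_classFreq_zero (n : ℕ) (ℓ z : Fin 3 → ℤ) : classFreq n ℓ z - classFreq n 0 z = ℓ := by
  funext i; simp [classFreq]

/-- `|n·z|² = n²|z|²`. [folklore] -/
theorem freqNormSq_classFreq_zero (n : ℕ) (z : Fin 3 → ℤ) : freqNormSq (classFreq n 0 z) = (n : ℝ) ^ 2 * freqNormSq z := by
  simp only [freqNormSq, classFreq_zero_left, Finset.mul_sum]
  refine Finset.sum_congr rfl fun i _ => ?_
  push_cast; ring

/-- `(n·z)·v = n·(z·v)`. [folklore] -/
theorem kdot_classFreq_zero (n : ℕ) (z : Fin 3 → ℤ) (v : EuclideanSpace ℂ (Fin 3)) :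
    kdot (classFreq n 0 z) v = (n : ℂ) * kdot z v := by
  simp only [kdot_apply, classFreq_zero_left, Finset.mul_sum]
  refine Finset.sum_congr rfl fun i _ => ?_
  push_cast; ring

/-- `waveVecC (n·z) = n • waveVecC z`. [folklore] -/
theorem waveVecC_classFreq_zero (n : ℕ) (z : Fin 3 → ℤ) : waveVecC (classFreq n 0 z) = (n : ℂ) • waveVecC z := by
  ext i
  simp [waveVecC_apply, classFreq_zero_left]

/-- **Homogeneity of the symbol**: `T_𝔸(n·z) = n²·T_𝔸(z)`. [cite: Frisch1995Turbulence, §9.6.3 eq. (9.57) p. 233] -/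
theorem symbT_classFreq_zero (𝔸 : Torus.Visc4 (Fin 3)) (n : ℕ) (z : Fin 3 → ℤ) (v : EuclideanSpace ℂ (Fin 3)) :
    Torus.symbT 𝔸 (classFreq n 0 z) v = ((n : ℂ) ^ 2) • Torus.symbT 𝔸 z v := by
  ext j
  simp only [Torus.symbT_apply, classFreq_zero_left, PiLp.smul_apply, smul_eq_mul, Finset.mul_sum]
  refine Finset.sum_congr rfl fun i _ => Finset.sum_congr rfl fun a _ => Finset.sum_congr rfl fun b _ => ?_
  push_cast; ring

/-- **Scale invariance of the Leray projection**: `P_{n·z} = P_z` (`n ≥ 1`). [cite: Temam1984, Ch. III §1.1] -/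
theorem transversalProj_classFreq_zero {n : ℕ} (hn : n ≠ 0) (z : Fin 3 → ℤ) (v : EuclideanSpace ℂ (Fin 3)) :
    transversalProj (classFreq n 0 z) v = transversalProj z v := by
  by_cases hz : z = 0
  · subst hz
    have : classFreq n 0 0 = 0 := by funext i; simp [classFreq]
    rw [this]
  have hn' : (n : ℂ) ≠ 0 := by exact_mod_cast hn
  have hF : (freqNormSq z : ℂ) ≠ 0 := by exact_mod_cast (freqNormSq_pos_of_ne_zero' hz).ne'
  rw [transversalProj_apply, transversalProj_apply, freqNormSq_classFreq_zero, kdot_classFreq_zero, waveVecC_classFreq_zero, smul_smul]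
  congr 1
  push_cast
  field_simp

/-! ## §3 The Leray projection of a nearby direction -/

/-- `‖waveVecC k‖ = √|k|²`. [folklore] -/
theorem norm_waveVecC (k : Fin 3 → ℤ) : ‖waveVecC k‖ = Real.sqrt (freqNormSq k) := by
  rw [← W7Slot.norm_waveVecC_sq, Real.sqrt_sq (norm_nonneg _)]

/-- `waveVecC k − waveVecC k₀ = waveVecC (k − k₀)`. [folklore] -/
theorem waveVecC_sub (k k₀ : Fin 3 → ℤ) : waveVecC k - waveVecC k₀ = waveVecC (k - k₀) := by
  ext i; simp [waveVecC_apply]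

/-- **The projection kills its own direction, hence nearly kills a nearby one**: `‖P_k (waveVecC k₀)‖ ≤ √|k − k₀|²`.
[cite: Temam1984, Ch. III §1.1] -/
theorem norm_transversalProj_waveVecC_le (k k₀ : Fin 3 → ℤ) :
    ‖transversalProj k (waveVecC k₀)‖ ≤ Real.sqrt (freqNormSq (k - k₀)) := by
  have h0 : transversalProj k (waveVecC k) = 0 := by
    by_cases hk : k = 0
    · subst hk
      have hw : waveVecC (0 : Fin 3 → ℤ) = 0 := by ext i; simp [waveVecC_apply]
      rw [hw, map_zero]
    have hF : (freqNormSq k : ℂ) ≠ 0 := by exact_mod_cast (freqNormSq_pos_of_ne_zero' hk).ne'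
    rw [transversalProj_apply, kdot_waveVecC, inv_mul_cancel₀ hF, one_smul, sub_self]
  have h1 : transversalProj k (waveVecC k₀) = -(transversalProj k (waveVecC k - waveVecC k₀)) := by
    rw [map_sub, h0, zero_sub, neg_neg]
  rw [h1, norm_neg, waveVecC_sub]
  calc ‖transversalProj k (waveVecC (k - k₀))‖ ≤ ‖waveVecC (k - k₀)‖ := CellChain.norm_transversalProj_le _ _
    _ = Real.sqrt (freqNormSq (k - k₀)) := norm_waveVecC _

/-- `|k₀·v| ≤ √|k₀|²·‖v‖`. [folklore] -/
theorem norm_kdot_le (k₀ : Fin 3 → ℤ) (v : EuclideanSpace ℂ (Fin 3)) : ‖kdot k₀ v‖ ≤ Real.sqrt (freqNormSq k₀) * ‖v‖ := by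
  rw [← inner_waveVecC_left, ← norm_waveVecC]
  exact norm_inner_le_norm _ _

/-- **The longitudinal part at `k₀` is nearly transversal at a nearby `k`**: `‖P_k (v − P_{k₀} v)‖ ≤ (√|k−k₀|²/√|k₀|²)·‖v‖` (`k₀ ≠ 0`) — the source
defect `P_{k_{mⱼ}}(x − P_{mⱼ} x)` of the refined T4 is `O(|ξ|)·‖x‖`. [cite: Temam1984, Ch. III §1.1] -/
theorem norm_transversalProj_sub_proj_le (k : Fin 3 → ℤ) {k₀ : Fin 3 → ℤ} (hk₀ : k₀ ≠ 0) (v : EuclideanSpace ℂ (Fin 3)) :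
    ‖transversalProj k (v - transversalProj k₀ v)‖ ≤ Real.sqrt (freqNormSq (k - k₀)) / Real.sqrt (freqNormSq k₀) * ‖v‖ := by
  have hF : 0 < freqNormSq k₀ := freqNormSq_pos_of_ne_zero' hk₀
  have hsq : 0 < Real.sqrt (freqNormSq k₀) := Real.sqrt_pos.2 hF
  have hlong : v - transversalProj k₀ v = ((freqNormSq k₀ : ℂ)⁻¹ * kdot k₀ v) • waveVecC k₀ := by
    rw [transversalProj_apply]; abel
  rw [hlong, map_smul, norm_smul, norm_mul, norm_inv, Complex.norm_real, Real.norm_eq_abs, abs_of_pos hF]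
  have h1 := norm_transversalProj_waveVecC_le k k₀
  have h2 := norm_kdot_le k₀ v
  have hsqF : Real.sqrt (freqNormSq k₀) * Real.sqrt (freqNormSq k₀) = freqNormSq k₀ := Real.mul_self_sqrt hF.le
  have hinv : (freqNormSq k₀)⁻¹ * Real.sqrt (freqNormSq k₀) = (Real.sqrt (freqNormSq k₀))⁻¹ := by
    nth_rw 1 [← hsqF]
    rw [mul_inv, mul_assoc, inv_mul_cancel₀ hsq.ne', mul_one]
  calc (freqNormSq k₀)⁻¹ * ‖kdot k₀ v‖ * ‖transversalProj k (waveVecC k₀)‖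
      ≤ (freqNormSq k₀)⁻¹ * (Real.sqrt (freqNormSq k₀) * ‖v‖) * Real.sqrt (freqNormSq (k - k₀)) := by
        gcongr
    _ = ((freqNormSq k₀)⁻¹ * Real.sqrt (freqNormSq k₀)) * ‖v‖ * Real.sqrt (freqNormSq (k - k₀)) := by ring
    _ = Real.sqrt (freqNormSq (k - k₀)) / Real.sqrt (freqNormSq k₀) * ‖v‖ := by
        rw [hinv, div_eq_mul_inv]; ring

/-! ## §4 The viscous ξ-defect pairing bound -/

/-- **THE VISCOUS ξ-DEFECT PAIRING BOUND** (FINDING F-w1g6-1): for `z ≠ 0`, `n ≥ 1`, `4|ℓ|² ≤ n²|z|²`, ALL `r, y ∈ ℂ³`, and `K₀` any transverse bound of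
`bsymb 𝔸`: `|Re⟪P_{k_z} r, T_{(1/n²)•𝔸}(k_z) P_{k_z} y⟫ − Re⟪P_z r, T_𝔸(z) P_z y⟫| ≤ 534·K₀·√|z|²·(√|ℓ|²/n)·‖y‖·‖r‖` (`k_z = ℓ + n·z`).
[cite: Frisch1995Turbulence, §9.6.3 eq. (9.57) p. 233] -/
theorem abs_re_visc_defect_le {𝔸 : Torus.Visc4 (Fin 3)} {K₀ : ℝ} (hK₀ : 0 ≤ K₀)
    (hK : ∀ k p q : Fin 3 → ℝ, ∑ i, p i * k i = 0 → ∑ i, q i * k i = 0 →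
      |Torus.bsymb 𝔸 k p q| ≤ K₀ * (∑ a, k a ^ 2) * (Real.sqrt (∑ i, p i ^ 2) * Real.sqrt (∑ i, q i ^ 2)))
    {n : ℕ} (hn : n ≠ 0) (ℓ : Fin 3 → ℤ) {z : Fin 3 → ℤ} (hz : z ≠ 0) (hclose : 4 * freqNormSq ℓ ≤ (n : ℝ) ^ 2 * freqNormSq z)
    (r y : EuclideanSpace ℂ (Fin 3)) :
    |(⟪transversalProj (classFreq n ℓ z) r, Torus.symbT ((1 / (n : ℝ) ^ 2) • 𝔸) (classFreq n ℓ z) (transversalProj (classFreq n ℓ z) y)⟫_ℂ).re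
        - (⟪transversalProj z r, Torus.symbT 𝔸 z (transversalProj z y)⟫_ℂ).re|
      ≤ 534 * K₀ * Real.sqrt (freqNormSq z) * (Real.sqrt (freqNormSq ℓ) / n) * (‖y‖ * ‖r‖) := by
  have hn0 : (0 : ℝ) < n := by exact_mod_cast Nat.pos_of_ne_zero hn
  have hnC : ((n : ℝ) : ℂ) ≠ 0 := by exact_mod_cast hn0.ne'
  have hk₀ : classFreq n 0 z ≠ 0 := by
    intro h
    apply hz
    funext i
    have := congrFun h i
    simp only [classFreq_zero_left, Pi.zero_apply, mul_eq_zero, Int.natCast_eq_zero] at this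
    exact this.resolve_left hn
  have hclose' : 4 * freqNormSq (classFreq n ℓ z - classFreq n 0 z) ≤ freqNormSq (classFreq n 0 z) := by
    rw [classFreq_sub_classFreq_zero, freqNormSq_classFreq_zero]; exact hclose
  have hmain := SymbolLipschitz.abs_re_inner_symbT_proj_sub_le hK₀ hK (classFreq n ℓ z) (classFreq n 0 z) hk₀ hclose' r y
  rw [classFreq_sub_classFreq_zero, freqNormSq_classFreq_zero, Real.sqrt_mul (sq_nonneg _), Real.sqrt_sq hn0.le] at hmain
  -- rewrite the reference term at `z` as the term at `n·z` scaled by `1/n²`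
  have href : (⟪transversalProj (classFreq n 0 z) r, Torus.symbT 𝔸 (classFreq n 0 z) (transversalProj (classFreq n 0 z) y)⟫_ℂ).re
      = (n : ℝ) ^ 2 * (⟪transversalProj z r, Torus.symbT 𝔸 z (transversalProj z y)⟫_ℂ).re := by
    rw [transversalProj_classFreq_zero hn, transversalProj_classFreq_zero hn, symbT_classFreq_zero, inner_smul_right]
    have : ((n : ℂ) ^ 2) = (((n : ℝ) ^ 2 : ℝ) : ℂ) := by push_cast; ring
    rw [this, Complex.re_ofReal_mul]
  have hcls : (⟪transversalProj (classFreq n ℓ z) r, Torus.symbT ((1 / (n : ℝ) ^ 2) • 𝔸) (classFreq n ℓ z) (transversalProj (classFreq n ℓ z) y)⟫_ℂ).re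
      = (1 / (n : ℝ) ^ 2) * (⟪transversalProj (classFreq n ℓ z) r, Torus.symbT 𝔸 (classFreq n ℓ z) (transversalProj (classFreq n ℓ z) y)⟫_ℂ).re := by
    rw [Torus.symbT_smul_tensor, inner_smul_right, Complex.re_ofReal_mul]
  rw [hcls]
  have hn2 : (0 : ℝ) < (n : ℝ) ^ 2 := by positivity
  have key : (1 / (n : ℝ) ^ 2) * (⟪transversalProj (classFreq n ℓ z) r, Torus.symbT 𝔸 (classFreq n ℓ z) (transversalProj (classFreq n ℓ z) y)⟫_ℂ).re
      - (⟪transversalProj z r, Torus.symbT 𝔸 z (transversalProj z y)⟫_ℂ).re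
      = (1 / (n : ℝ) ^ 2) * ((⟪transversalProj (classFreq n ℓ z) r, Torus.symbT 𝔸 (classFreq n ℓ z) (transversalProj (classFreq n ℓ z) y)⟫_ℂ).re
        - (⟪transversalProj (classFreq n 0 z) r, Torus.symbT 𝔸 (classFreq n 0 z) (transversalProj (classFreq n 0 z) y)⟫_ℂ).re) := by
    rw [href]; field_simp
  rw [key, abs_mul, abs_of_pos (by positivity : (0:ℝ) < 1 / (n : ℝ) ^ 2)]
  calc 1 / (n : ℝ) ^ 2 * |(⟪transversalProj (classFreq n ℓ z) r, Torus.symbT 𝔸 (classFreq n ℓ z) (transversalProj (classFreq n ℓ z) y)⟫_ℂ).re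
        - (⟪transversalProj (classFreq n 0 z) r, Torus.symbT 𝔸 (classFreq n 0 z) (transversalProj (classFreq n 0 z) y)⟫_ℂ).re|
      ≤ 1 / (n : ℝ) ^ 2 * (534 * K₀ * ((n : ℝ) * Real.sqrt (freqNormSq z)) * Real.sqrt (freqNormSq ℓ) * (‖y‖ * ‖r‖)) :=
        mul_le_mul_of_nonneg_left hmain (by positivity)
    _ = 534 * K₀ * Real.sqrt (freqNormSq z) * (Real.sqrt (freqNormSq ℓ) / n) * (‖y‖ * ‖r‖) := by
        field_simp

end Summit.AnomalousDissipation.AnomalousDissipation.Theorems.SolenoidalFractalHomogenisation.LagrangianStep.Sideband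

end
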